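import Literature.NumberTheory.LFunctions.ChebyshevSylvesterPrimeWindows
import Mathlib.NumberTheory.AbelSummation
import Mathlib.NumberTheory.ArithmeticFunction.Misc
import HarnessLib

/-!
# Ford's `𝒞(P,R)` and a lower bound for its cardinality (Ford 2002, Lemma 2.2)

Topic `Literature/NumberTheory/LFunctions`. Everything in this file is PROVED; no named fact is
introduced (the `def`s are the finite sets `𝒞(P,R)`, `N_d(P,R)` and the constants `c_d`).

K. Ford, *Vinogradov's integral and bounds for the Riemann zeta function*, Proc. London Math.
Soc. (3) 85 (2002), 565–633 (arXiv:1910.08209, whose numbering is used), §2: `𝒞(P,R)` is the set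
of positive integers `n ≤ P` all of whose prime factors lie in `(√R, R]` (`FordVK.calC`); it is
the set `ℬ` over which the incomplete systems `J_{s,g,h}(ℬ)` of Theorem 4 and Lemma 5.1
(`FordVK.ford_lemma51`, `FordLemma51.lean`) are counted in the proof of Theorem 2 for `λ ≥ 87`
(§5). **Lemma 2.2** of the source bounds `|𝒞(R^u,R)|` from below:
`|𝒞(R^u,R)| ≥ δ^w/(w+1)! · R^u/log R`, `w = ⌊u/(1−δ)⌋`, for `0 ≤ δ ≤ 1/10`, `u ≥ 2 − 3δ`,
`R ≥ 6^{1/δ}`, by an induction on the number of prime factors ((2.2):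
`N_d(R^u,R) ≥ δ^{d−1}/d! · R^u/log R` for `2 − 3δ ≤ u < d(1−δ)`) whose inputs are the
Rosser–Schoenfeld bounds (2.1) for `π(x)` and (2.3) for `∑_{p ≤ x} 1/p`.

Those Rosser–Schoenfeld bounds are not in the tree unconditionally. This file runs Ford's
induction VERBATIM but feeds it with the tree's explicit Chebyshev–Sylvester bounds
(`Literature.NumberTheory.LFunctions.theta_bounds_sylvester`: `0.9392x − 9√x − 2√x log x ≤ θ(x) ≤ 1.0722x + 7√x`), in the
form `0.939 x ≤ θ(x) ≤ 1.0723 x` (`x ≥ e^{40}`) and, by partial summation,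
`∑_{Y<p≤X} 1/p ≥ 0.939 log(log X/log Y) − 0.1333/log Y` (`Y ≥ e^{40}`). The price is a factor
`7/8` per prime (`∑_{R^{1−δ}<p≤R} 1/p ≥ 7δ/8` instead of `> δ`) and stronger largeness
hypotheses (`log R ≥ 80`, `δ log R ≥ 3` instead of `R ≥ 6^{1/δ}`):

* `FordVK.card_calC_ge` — **for `0 < δ ≤ 1/10`, `log R ≥ 80`, `δ log R ≥ 3`, `u ≥ 2 − 3δ`:
  `|𝒞(R^u,R)| ≥ (7δ/8)^w/(w+1)! · R^u/log R`, `w = ⌊u/(1−δ)⌋`**;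
* `FordVK.card_calC_ge_26` — the case `δ = 1/26` used in §5 of the source
  (`w = ⌊26u/25⌋`, constant `(7/208)^w/(w+1)!`, hypotheses `log R ≥ 80`, `u ≥ 2`).

In §5 the bound enters only through `C₃^{1/r}` in (5.19)/(5.30) with `r ≥ 7.5λ²`, where the
extra factor `(8/7)^{w/r} ≤ 1.011` is harmless (and `log R ≥ 84` there), so this weaker lemma
serves the proof of Theorem 2 for `λ ≥ 87` in place of Lemma 2.2.

## Contents

* `FordVK.calC`, `FordVK.calCN` (`N_d`), membership API, `one_mem_calC`, `calC_bounds`;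
* `FordVK.sum_card_calCN_div_le` — the counting step
  `∑_{A<p≤B} N_d(x/p,R) ≤ (d+1) N_{d+1}(x,R)` for a prime window `(A,B] ⊆ (√R,R]`;
* `FordVK.theta_bounds_exp40`, `FordVK.sum_inv_primes_Ioc_eq` (partial summation identity
  `∑_{Y<p≤X} 1/p = θ(X)/(X log X) − θ(Y)/(Y log Y) + ∫_Y^X θ(t)(log t+1)/(t² log² t) dt`),
  `FordVK.sum_inv_primes_Ioc_ge`, `FordVK.sum_inv_primes_rpow_ge`;
* `FordVK.calCN_one_ge_07`, `FordVK.calCN_one_ge_half` (`N₁` from `θ`), the cases `d = 2, 3`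
  (`calCN_two_ge`, `calCN_three_ge`), the induction `calCN_ge_induction`, and the two main
  statements.

## References

* K. Ford, Proc. London Math. Soc. (3) 85 (2002), 565–633; arXiv:1910.08209: §2, Lemma 2.2 and
  its proof ((2.2)), and §5, (5.19). [Ford2002]
* J. J. Sylvester (1881/1892), via `ChebyshevSylvesterPsi.lean`. [Sylvester1892]
-/

open Finset Real

namespace Literature.NumberTheory.LFunctions
namespace FordVK

/-- Ford's `𝒞(P,R)`: the positive integers `n ≤ P` all of whose prime factors lie in `(√R, R]`
(so `1 ∈ 𝒞(P,R)` for `P ≥ 1`). [cite: Ford2002, §2 (notation)] -/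
noncomputable def calC (P R : ℝ) : Finset ℕ :=
  (Finset.Icc 1 ⌊P⌋₊).filter fun n => ∀ p ∈ n.primeFactors, Real.sqrt R < p ∧ (p : ℝ) ≤ R

/-- `N_d(P,R)`: the elements of `𝒞(P,R)` with at most `d` prime factors counted with multiplicity.
[cite: Ford2002, proof of Lemma 2.2] -/
noncomputable def calCN (d : ℕ) (P R : ℝ) : Finset ℕ :=
  (calC P R).filter fun n => ArithmeticFunction.cardFactors n ≤ d

/-- Membership in `𝒞(P,R)`. [folklore] -/
theorem mem_calC {P R : ℝ} {n : ℕ} :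
    n ∈ calC P R ↔ 1 ≤ n ∧ n ≤ ⌊P⌋₊ ∧ ∀ p ∈ n.primeFactors, Real.sqrt R < p ∧ (p : ℝ) ≤ R := by
  simp [calC, and_assoc]

/-- Membership in `N_d(P,R)`. [folklore] -/
theorem mem_calCN {d : ℕ} {P R : ℝ} {n : ℕ} :
    n ∈ calCN d P R ↔ n ∈ calC P R ∧ ArithmeticFunction.cardFactors n ≤ d := by
  simp [calCN]

/-- `N_d(P,R) ⊆ 𝒞(P,R)`. [folklore] -/
theorem calCN_subset (d : ℕ) (P R : ℝ) : calCN d P R ⊆ calC P R := filter_subset _ _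

/-- `N_d ⊆ N_{d'}` for `d ≤ d'`. [folklore] -/
theorem calCN_mono {d d' : ℕ} (h : d ≤ d') (P R : ℝ) : calCN d P R ⊆ calCN d' P R := by
  intro n hn
  rw [mem_calCN] at hn ⊢
  exact ⟨hn.1, hn.2.trans h⟩

/-- `𝒞(P,R) ⊆ [1, ⌊P⌋]`. [folklore] -/
theorem calC_subset_Icc (P R : ℝ) : calC P R ⊆ Finset.Icc 1 ⌊P⌋₊ := filter_subset _ _

/-- `1 ∈ 𝒞(P,R)` for `P ≥ 1` (so `𝒞(P,R)` is nonempty). [folklore] -/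
theorem one_mem_calC {P : ℝ} (hP : 1 ≤ P) (R : ℝ) : 1 ∈ calC P R := by
  rw [mem_calC]
  exact ⟨le_refl 1, Nat.le_floor (by simpa using hP), fun p hp => by simp at hp⟩

/-- `𝒞(P,R)` is nonempty for `P ≥ 1`. [folklore] -/
theorem calC_nonempty {P : ℝ} (hP : 1 ≤ P) (R : ℝ) : (calC P R).Nonempty := ⟨1, one_mem_calC hP R⟩

/-- Elements of `𝒞(P,R)` satisfy `1 ≤ b ≤ P` (the shape of the hypothesis `hBB` of
`FordVK.ford_lemma51`). [folklore] -/
theorem calC_bounds {P R : ℝ} (hP : 0 ≤ P) : ∀ b ∈ calC P R, 1 ≤ b ∧ (b : ℝ) ≤ P := by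
  intro b hb
  rw [mem_calC] at hb
  exact ⟨hb.1, (Nat.le_floor_iff hP).1 hb.2.1⟩

/-- **The counting step**: for primes `p` in a window `(A, B] ⊆ (√R, R]`,
`∑_p N_d(x/p, R) ≤ (d+1) N_{d+1}(x, R)` (each `n = p m` is counted at most `ω(n) ≤ d+1` times).
[cite: Ford2002, proof of Lemma 2.2] -/
theorem sum_card_calCN_div_le {d : ℕ} {x A B R : ℝ} (hx : 0 ≤ x) (hA : Real.sqrt R ≤ A)
    (hB : B ≤ R) (hA0 : 0 ≤ A) :
    ∑ p ∈ (Finset.Ioc ⌊A⌋₊ ⌊B⌋₊).filter Nat.Prime, (calCN d (x / p) R).card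
      ≤ (d + 1) * (calCN (d + 1) x R).card := by
  classical
  set S := (Finset.Ioc ⌊A⌋₊ ⌊B⌋₊).filter Nat.Prime with hS
  set T := S.sigma fun p => calCN d (x / p) R with hT
  have hSmem : ∀ p ∈ S, p.Prime ∧ Real.sqrt R < p ∧ (p : ℝ) ≤ R := by
    intro p hp
    rw [hS, mem_filter, Finset.mem_Ioc] at hp
    refine ⟨hp.2, ?_, ?_⟩
    · have h1 : A < p := by
        have := hp.1.1
        exact (Nat.floor_lt hA0).1 this
      exact lt_of_le_of_lt hA h1
    · have h2 : p ≤ ⌊B⌋₊ := hp.1.2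
      have hB1 : 1 ≤ B := by
        have : 0 < ⌊B⌋₊ := by have := hp.1.1; omega
        exact_mod_cast (Nat.floor_pos.1 this)
      exact le_trans ((Nat.le_floor_iff (by linarith)).1 h2) hB
  -- the product map lands in `N_{d+1}(x, R)`
  set f : (Σ _ : ℕ, ℕ) → ℕ := fun q => q.1 * q.2 with hf
  have himage : T.image f ⊆ calCN (d + 1) x R := by
    intro n hn
    rw [Finset.mem_image] at hn
    obtain ⟨⟨p, m⟩, hq, rfl⟩ := hn
    rw [hT, Finset.mem_sigma] at hq
    obtain ⟨hp, hm⟩ := hq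
    obtain ⟨hpP, hpR1, hpR2⟩ := hSmem p hp
    dsimp only at hm
    rw [mem_calCN, mem_calC] at hm ⊢
    obtain ⟨⟨hm1, hm2, hm3⟩, hm4⟩ := hm
    have hp0 : 0 < p := hpP.pos
    have hp0' : (0 : ℝ) < p := by exact_mod_cast hp0
    simp only [hf]
    refine ⟨⟨?_, ?_, ?_⟩, ?_⟩
    · exact le_trans hm1 (Nat.le_mul_of_pos_left m hp0)
    · refine Nat.le_floor ?_
      have : (m : ℝ) ≤ x / p := by
        have := (Nat.le_floor_iff (by positivity)).1 hm2
        exact this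
      push_cast
      rw [le_div_iff₀ hp0'] at this
      linarith
    · intro q hq
      have hm0 : m ≠ 0 := by omega
      rw [Nat.primeFactors_mul hp0.ne' hm0, Finset.mem_union] at hq
      rcases hq with hq | hq
      · rw [hpP.primeFactors, Finset.mem_singleton] at hq
        subst hq
        exact ⟨hpR1, hpR2⟩
      · exact hm3 q hq
    · have hm0 : m ≠ 0 := by omega
      rw [ArithmeticFunction.cardFactors_mul hp0.ne' hm0, ArithmeticFunction.cardFactors_apply_prime hpP]
      omega
  -- fibres: at most `d + 1` preimages
  have hfib : ∀ n ∈ T.image f, (T.filter fun q => f q = n).card ≤ d + 1 := by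
    intro n hn
    have hn' := himage hn
    rw [mem_calCN, mem_calC] at hn'
    have hn0 : n ≠ 0 := by omega
    calc (T.filter fun q => f q = n).card ≤ n.primeFactors.card := by
          refine Finset.card_le_card_of_injOn (fun q => q.1) ?_ ?_
          · intro q hq
            rw [Finset.mem_coe, mem_filter, hT, Finset.mem_sigma] at hq
            obtain ⟨⟨hp, _⟩, hqn⟩ := hq
            have hpP := (hSmem q.1 hp).1
            rw [Finset.mem_coe, Nat.mem_primeFactors]
            refine ⟨hpP, ?_, hn0⟩
            rw [← hqn, hf]
            exact Dvd.intro _ rfl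
          · intro q hq q' hq' heq
            rw [Finset.mem_coe, mem_filter] at hq hq'
            have h1 : q.1 * q.2 = n := hq.2
            have h2 : q'.1 * q'.2 = n := hq'.2
            have hp0 : 0 < q.1 := by
              have := (hSmem q.1 (by have := hq.1; rw [hT, Finset.mem_sigma] at this; exact this.1)).1
              exact this.pos
            simp only at heq
            have : q.2 = q'.2 := by
              rw [← h2, heq] at h1
              exact Nat.eq_of_mul_eq_mul_left (heq ▸ hp0) h1
            exact Sigma.ext heq (heq_of_eq this)
      _ ≤ ArithmeticFunction.cardFactors n := by
          -- `ω(n) ≤ Ω(n)`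
          rw [ArithmeticFunction.cardFactors_apply, Nat.primeFactors]
          exact List.toFinset_card_le _
      _ ≤ d + 1 := hn'.2
  have h1 : T.card ≤ (d + 1) * (T.image f).card := Finset.card_le_mul_card_image T (d + 1) hfib
  have h2 : (T.image f).card ≤ (calCN (d + 1) x R).card := Finset.card_le_card himage
  have h3 : T.card = ∑ p ∈ S, (calCN d (x / p) R).card := by rw [hT, Finset.card_sigma]
  rw [← h3]
  exact h1.trans (Nat.mul_le_mul_left _ h2)

open scoped Chebyshev
open MeasureTheory Set

/-! ### Chebyshev–Sylvester bounds in the range `x ≥ e^{40}` -/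

/-- `e^{40} ≥ 140^8`. [folklore] -/
theorem pow_140_le_exp_40 : (140 : ℝ) ^ 8 ≤ Real.exp 40 := by
  have h1 : (2.7182818283 : ℝ) ≤ Real.exp 1 := Real.exp_one_gt_d9.le
  have h2 : (2.7182818283 : ℝ) ^ 40 ≤ Real.exp 1 ^ 40 := by gcongr
  rw [show (40 : ℝ) = ((40 : ℕ) : ℝ) by norm_num, ← Real.exp_one_pow 40]
  refine le_trans ?_ h2
  norm_num

/-- For `x ≥ e^{40}`: `9√x + 2√x log x ≤ 0.0002 x` and `7 √x ≤ 0.0001 x`. [folklore] -/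
theorem sqrt_error_small {x : ℝ} (hx : Real.exp 40 ≤ x) :
    9 * Real.sqrt x + 2 * Real.sqrt x * Real.log x ≤ 0.0002 * x ∧
      7 * Real.sqrt x ≤ 0.0001 * x := by
  have hx0 : 0 < x := lt_of_lt_of_le (Real.exp_pos 40) hx
  set y : ℝ := x ^ ((1 : ℝ) / 8) with hy
  have hy0 : 0 ≤ y := Real.rpow_nonneg hx0.le _
  have hy8 : y ^ 8 = x := by
    rw [hy, ← Real.rpow_natCast, ← Real.rpow_mul hx0.le]; norm_num
  have hy4 : y ^ 4 = Real.sqrt x := by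
    rw [hy, ← Real.rpow_natCast, ← Real.rpow_mul hx0.le, Real.sqrt_eq_rpow]; norm_num
  have hy140 : 140 ≤ y := by
    have : (140 : ℝ) ^ 8 ≤ y ^ 8 := by rw [hy8]; exact pow_140_le_exp_40.trans hx
    exact le_of_pow_le_pow_left₀ (by norm_num) hy0 this
  have hlog : Real.log x ≤ 8 * y := by
    have := Real.log_le_rpow_div hx0.le (by norm_num : (0 : ℝ) < 1 / 8)
    rw [← hy] at this
    linarith
  have hy3 : (140 : ℝ) ^ 3 ≤ y ^ 3 := by gcongr
  have hy4' : (140 : ℝ) ^ 4 ≤ y ^ 4 := by gcongr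
  have h4 : 0 ≤ y ^ 4 := by positivity
  have h5 : 0 ≤ y ^ 5 := by positivity
  have h85 : (140 : ℝ) ^ 3 * y ^ 5 ≤ y ^ 8 := by
    rw [show y ^ 8 = y ^ 3 * y ^ 5 by ring]
    exact mul_le_mul_of_nonneg_right hy3 h5
  have h54 : (140 : ℝ) * y ^ 4 ≤ y ^ 5 := by
    rw [show y ^ 5 = y * y ^ 4 by ring]
    exact mul_le_mul_of_nonneg_right hy140 h4
  have h84 : (140 : ℝ) ^ 4 * y ^ 4 ≤ y ^ 8 := by
    rw [show y ^ 8 = y ^ 4 * y ^ 4 by ring]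
    exact mul_le_mul_of_nonneg_right hy4' h4
  rw [← hy4, show (0.0002 : ℝ) * x = 0.0002 * y ^ 8 by rw [hy8],
    show (0.0001 : ℝ) * x = 0.0001 * y ^ 8 by rw [hy8]]
  constructor
  · -- 9 y⁴ + 2 y⁴ log x ≤ 9 y⁴ + 16 y⁵ ≤ 0.0002 y⁸
    have h1 : 2 * y ^ 4 * Real.log x ≤ 16 * y ^ 5 := by
      rw [show (16 : ℝ) * y ^ 5 = 2 * y ^ 4 * (8 * y) by ring]
      exact mul_le_mul_of_nonneg_left hlog (by positivity)
    nlinarith [h85, h54, h1]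
  · nlinarith [h84]

/-- **`0.939 x ≤ θ(x) ≤ 1.0723 x` for `x ≥ e^{40}`** (from the tree's Chebyshev–Sylvester bounds
`0.9392 x − 9√x − 2√x log x ≤ θ(x) ≤ 1.0722 x + 7√x`).
[cite: Sylvester1892, pp. 87–120 (scheme [1,6,70;2,3,5,7,210])] -/
theorem theta_bounds_exp40 {x : ℝ} (hx : Real.exp 40 ≤ x) :
    0.939 * x ≤ θ x ∧ θ x ≤ 1.0723 * x := by
  have hx1 : 1 ≤ x := le_trans (by have := Real.add_one_le_exp (40 : ℝ); linarith) hx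
  have h := theta_bounds_sylvester hx1
  have h' := sqrt_error_small hx
  constructor <;> nlinarith [h.1, h.2, h'.1, h'.2]

/-! ### `N₁(y, R)` contains the primes of `(√R, y]` -/

/-- For `y ≤ R`, every prime of `(√R, y]` lies in `N₁(y,R)`; hence
`#{primes in (√R, y]} ≤ N₁(y, R)`. [cite: Ford2002, proof of Lemma 2.2] -/
theorem card_primes_le_calCN_one {y R : ℝ} (hyR : y ≤ R) :
    ((Finset.Ioc ⌊Real.sqrt R⌋₊ ⌊y⌋₊).filter Nat.Prime).card ≤ (calCN 1 y R).card := by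
  refine Finset.card_le_card fun p hp => ?_
  rw [mem_filter, Finset.mem_Ioc] at hp
  obtain ⟨⟨hp1, hp2⟩, hpP⟩ := hp
  have hy0 : 0 ≤ y := by
    have : 0 < ⌊y⌋₊ := by omega
    have := Nat.floor_pos.1 this
    linarith
  rw [mem_calCN, mem_calC]
  refine ⟨⟨hpP.one_le, hp2, fun q hq => ?_⟩, by rw [ArithmeticFunction.cardFactors_apply_prime hpP]⟩
  rw [hpP.primeFactors, Finset.mem_singleton] at hq
  subst hq
  refine ⟨(Nat.floor_lt (Real.sqrt_nonneg R)).1 hp1, ?_⟩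
  exact le_trans ((Nat.le_floor_iff hy0).1 hp2) hyR

/-- **`N₁(y,R) ≥ (θ(y) − θ(√R))/log y`** for `1 ≤ √R ≤ y ≤ R`. [cite: Ford2002, proof of Lemma 2.2] -/
theorem theta_sub_le_calCN_one_mul_log {y R : ℝ} (hR : 1 ≤ Real.sqrt R) (hy : Real.sqrt R ≤ y)
    (hyR : y ≤ R) :
    θ y - θ (Real.sqrt R) ≤ (calCN 1 y R).card * Real.log y := by
  have h1 := Sylvester.theta_sub_theta_le_card_mul_log hR hy
  have h2 := card_primes_le_calCN_one hyR
  have hlog : 0 ≤ Real.log y := Real.log_nonneg (hR.trans hy)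
  exact h1.trans (mul_le_mul_of_nonneg_right (by exact_mod_cast h2) hlog)

/-! ### The prime reciprocal sum on `(Y, X]` by partial summation from `θ` -/

/-- The weight `f(t) = 1/(t log t)` has derivative `-(log t + 1)/(t² log² t)` for `t > 1`.
[folklore] -/
theorem hasDerivAt_inv_mul_log {t : ℝ} (ht : 1 < t) :
    HasDerivAt (fun u : ℝ => (u * Real.log u)⁻¹)
      (-(Real.log t + 1) / (t ^ 2 * Real.log t ^ 2)) t := by
  have ht0 : t ≠ 0 := by linarith
  have hlog : Real.log t ≠ 0 := (Real.log_pos ht).ne'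
  have h1 : HasDerivAt (fun u : ℝ => u * Real.log u) (1 * Real.log t + t * t⁻¹) t :=
    (hasDerivAt_id t).mul (Real.hasDerivAt_log ht0)
  have h2 := h1.inv (mul_ne_zero ht0 hlog)
  refine h2.congr_deriv ?_
  rw [mul_inv_cancel₀ ht0, one_mul]
  field_simp

/-- The antiderivative `F(t) = log log t − 1/log t` of `(log t + 1)/(t log² t)` (`t > 1`).
[folklore] -/
theorem hasDerivAt_loglog_sub_inv_log {t : ℝ} (ht : 1 < t) :
    HasDerivAt (fun u : ℝ => Real.log (Real.log u) - (Real.log u)⁻¹)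
      ((Real.log t + 1) / (t * Real.log t ^ 2)) t := by
  have ht0 : t ≠ 0 := by linarith
  have hlog : Real.log t ≠ 0 := (Real.log_pos ht).ne'
  have h1 : HasDerivAt (fun u : ℝ => Real.log (Real.log u)) (t⁻¹ / Real.log t) t :=
    (Real.hasDerivAt_log ht0).log hlog
  have h2 : HasDerivAt (fun u : ℝ => (Real.log u)⁻¹) (-t⁻¹ / Real.log t ^ 2) t :=
    (Real.hasDerivAt_log ht0).inv hlog
  refine (h1.sub h2).congr_deriv ?_
  field_simp
  ring

/-- **Partial summation**: for `2 ≤ Y ≤ X`,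
`∑_{Y < p ≤ X} 1/p = θ(X)/(X log X) − θ(Y)/(Y log Y) + ∫_Y^X θ(t)(log t + 1)/(t² log² t) dt`.
[folklore] -/
theorem sum_inv_primes_Ioc_eq {Y X : ℝ} (hY : 2 ≤ Y) (hYX : Y ≤ X) :
    ∑ p ∈ (Finset.Ioc ⌊Y⌋₊ ⌊X⌋₊).filter Nat.Prime, (1 : ℝ) / p
      = θ X / (X * Real.log X) - θ Y / (Y * Real.log Y)
        + ∫ t in Ioc Y X, (Real.log t + 1) / (t ^ 2 * Real.log t ^ 2) * θ t := by
  set c : ℕ → ℝ := fun k => if k.Prime then Real.log k else 0 with hc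
  set f : ℝ → ℝ := fun t => (t * Real.log t)⁻¹ with hf
  have hS : ∀ t : ℝ, ∑ k ∈ Icc 0 ⌊t⌋₊, c k = θ t := fun t ↦ by
    rw [Chebyshev.theta_eq_sum_Icc, Finset.sum_filter]
  have hf_diff : ∀ t ∈ Set.Icc Y X, DifferentiableAt ℝ f t := fun t ht =>
    (hasDerivAt_inv_mul_log (by linarith [ht.1])).differentiableAt
  have hderiv_eq : ∀ t ∈ Set.Icc Y X,
      deriv f t = -(Real.log t + 1) / (t ^ 2 * Real.log t ^ 2) := fun t ht =>
    (hasDerivAt_inv_mul_log (by linarith [ht.1])).deriv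
  have hg_cont : ContinuousOn (fun t : ℝ ↦ -(Real.log t + 1) / (t ^ 2 * Real.log t ^ 2))
      (Set.Icc Y X) := by
    refine ContinuousOn.div ?_ ?_ ?_
    · exact ((Real.continuousOn_log.mono fun t (ht : t ∈ Set.Icc Y X) =>
        Set.mem_compl_singleton_iff.mpr (by linarith [ht.1])).add continuousOn_const).neg
    · exact (continuousOn_pow 2).mul ((Real.continuousOn_log.mono fun t (ht : t ∈ Set.Icc Y X) =>
        Set.mem_compl_singleton_iff.mpr (by linarith [ht.1])).pow 2)
    · intro t ht
      have : (0 : ℝ) < Real.log t := Real.log_pos (by linarith [ht.1])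
      have ht0 : (0 : ℝ) < t := by linarith [ht.1]
      positivity
  have hf_int : IntegrableOn (deriv f) (Set.Icc Y X) :=
    hg_cont.integrableOn_Icc.congr_fun (fun t ht => (hderiv_eq t ht).symm) measurableSet_Icc
  have habel := sum_mul_eq_sub_sub_integral_mul c (by linarith : (0 : ℝ) ≤ Y) hYX hf_diff hf_int
  have hfc : ∀ k : ℕ, f k * c k = if k.Prime then (1 : ℝ) / k else 0 := by
    intro k
    simp only [hf, hc]
    split_ifs with hk
    · have hk0 : (k : ℝ) ≠ 0 := by exact_mod_cast hk.ne_zero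
      have hlk : Real.log k ≠ 0 := (Real.log_pos (by exact_mod_cast hk.one_lt)).ne'
      field_simp
    · simp
  have hlhs : ∑ k ∈ Finset.Ioc ⌊Y⌋₊ ⌊X⌋₊, f k * c k
      = ∑ p ∈ (Finset.Ioc ⌊Y⌋₊ ⌊X⌋₊).filter Nat.Prime, (1 : ℝ) / p := by
    rw [Finset.sum_filter]
    exact Finset.sum_congr rfl fun k _ => hfc k
  have hbX : f X * ∑ k ∈ Icc 0 ⌊X⌋₊, c k = θ X / (X * Real.log X) := by
    rw [hS, hf]; simp only; rw [div_eq_inv_mul]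
  have hbY : f Y * ∑ k ∈ Icc 0 ⌊Y⌋₊, c k = θ Y / (Y * Real.log Y) := by
    rw [hS, hf]; simp only; rw [div_eq_inv_mul]
  have hint : ∫ t in Set.Ioc Y X, deriv f t * ∑ k ∈ Icc 0 ⌊t⌋₊, c k =
      -∫ t in Ioc Y X, (Real.log t + 1) / (t ^ 2 * Real.log t ^ 2) * θ t := by
    rw [← integral_neg]
    refine setIntegral_congr_fun measurableSet_Ioc fun t ht ↦ ?_
    rw [hderiv_eq t (Set.Ioc_subset_Icc_self ht), hS]
    ring
  rw [hlhs, hbX, hbY, hint] at habel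
  linarith

/-- Integrability of `θ(t)(log t + 1)/(t² log² t)` on `(Y, X]`, `Y ≥ 2`. [folklore] -/
theorem integrableOn_weight_mul_theta {Y X : ℝ} (hY : 2 ≤ Y) :
    IntegrableOn (fun t : ℝ => (Real.log t + 1) / (t ^ 2 * Real.log t ^ 2) * θ t) (Ioc Y X) := by
  set c : ℕ → ℝ := fun k => if k.Prime then Real.log k else 0 with hc
  have hS : ∀ t : ℝ, ∑ k ∈ Icc 0 ⌊t⌋₊, c k = θ t := fun t ↦ by
    rw [Chebyshev.theta_eq_sum_Icc, Finset.sum_filter]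
  have hg_cont : ContinuousOn (fun t : ℝ ↦ (Real.log t + 1) / (t ^ 2 * Real.log t ^ 2))
      (Set.Icc Y X) := by
    refine ContinuousOn.div ?_ ?_ ?_
    · exact ((Real.continuousOn_log.mono fun t (ht : t ∈ Set.Icc Y X) =>
        Set.mem_compl_singleton_iff.mpr (by linarith [ht.1])).add continuousOn_const)
    · exact (continuousOn_pow 2).mul ((Real.continuousOn_log.mono fun t (ht : t ∈ Set.Icc Y X) =>
        Set.mem_compl_singleton_iff.mpr (by linarith [ht.1])).pow 2)
    · intro t ht
      have : (0 : ℝ) < Real.log t := Real.log_pos (by linarith [ht.1])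
      have ht0 : (0 : ℝ) < t := by linarith [ht.1]
      positivity
  have h := integrableOn_mul_sum_Icc c (m := 0) (by linarith : (0 : ℝ) ≤ Y) hg_cont.integrableOn_Icc
    (b := X)
  have h' : IntegrableOn (fun t : ℝ => (Real.log t + 1) / (t ^ 2 * Real.log t ^ 2) * θ t)
      (Set.Icc Y X) := by
    refine h.congr_fun (fun t _ => ?_) measurableSet_Icc
    simp only [hS]
  exact h'.mono_set Set.Ioc_subset_Icc_self

/-- **Chebyshev-strength Mertens lower bound**: for `e^{40} ≤ Y ≤ X`,
`∑_{Y < p ≤ X} 1/p ≥ 0.939 (log log X − log log Y) − 0.1333/log Y`.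
[cite: Ford2002, (2.3) (here replaced by the weaker bound that follows from Chebyshev–Sylvester)] -/
theorem sum_inv_primes_Ioc_ge {Y X : ℝ} (hY : Real.exp 40 ≤ Y) (hYX : Y ≤ X) :
    0.939 * (Real.log (Real.log X) - Real.log (Real.log Y)) - 0.1333 / Real.log Y
      ≤ ∑ p ∈ (Finset.Ioc ⌊Y⌋₊ ⌊X⌋₊).filter Nat.Prime, (1 : ℝ) / p := by
  have hY2 : (2 : ℝ) ≤ Y := le_trans (by have := Real.add_one_le_exp (40 : ℝ); linarith) hY
  have hX : Real.exp 40 ≤ X := hY.trans hYX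
  have hY0 : 0 < Y := by linarith
  have hX0 : 0 < X := by linarith
  have hlY : 40 ≤ Real.log Y := by
    have := Real.log_le_log (Real.exp_pos 40) hY; rwa [Real.log_exp] at this
  have hlX : 40 ≤ Real.log X := by
    have := Real.log_le_log (Real.exp_pos 40) hX; rwa [Real.log_exp] at this
  have hlY0 : 0 < Real.log Y := by linarith
  have hlX0 : 0 < Real.log X := by linarith
  rw [sum_inv_primes_Ioc_eq hY2 hYX]
  obtain ⟨hθX, -⟩ := theta_bounds_exp40 hX
  obtain ⟨-, hθY⟩ := theta_bounds_exp40 hY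
  -- boundary terms
  have h1 : 0.939 / Real.log X ≤ θ X / (X * Real.log X) := by
    rw [div_le_div_iff₀ hlX0 (by positivity)]
    nlinarith
  have h2 : θ Y / (Y * Real.log Y) ≤ 1.0723 / Real.log Y := by
    rw [div_le_div_iff₀ (by positivity) hlY0]
    nlinarith
  -- the integral
  set F : ℝ → ℝ := fun u => Real.log (Real.log u) - (Real.log u)⁻¹ with hF
  have hcont : ContinuousOn (fun t : ℝ ↦ (Real.log t + 1) / (t * Real.log t ^ 2)) (Set.Icc Y X) := by
    refine ContinuousOn.div ?_ ?_ ?_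
    · exact ((Real.continuousOn_log.mono fun t (ht : t ∈ Set.Icc Y X) =>
        Set.mem_compl_singleton_iff.mpr (by linarith [ht.1])).add continuousOn_const)
    · exact continuousOn_id.mul ((Real.continuousOn_log.mono fun t (ht : t ∈ Set.Icc Y X) =>
        Set.mem_compl_singleton_iff.mpr (by linarith [ht.1])).pow 2)
    · intro t ht
      have : (0 : ℝ) < Real.log t := Real.log_pos (by linarith [ht.1])
      have ht0 : (0 : ℝ) < t := by linarith [ht.1]
      positivity
  have hFTC : ∫ t in Ioc Y X, (Real.log t + 1) / (t * Real.log t ^ 2) = F X - F Y := by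
    rw [← intervalIntegral.integral_of_le hYX]
    refine intervalIntegral.integral_eq_sub_of_hasDerivAt (fun t ht => ?_) ?_
    · rw [Set.uIcc_of_le hYX] at ht
      exact hasDerivAt_loglog_sub_inv_log (by linarith [ht.1])
    · exact (hcont.mono (by rw [Set.uIcc_of_le hYX])).intervalIntegrable
  have h3 : 0.939 * (F X - F Y)
      ≤ ∫ t in Ioc Y X, (Real.log t + 1) / (t ^ 2 * Real.log t ^ 2) * θ t := by
    rw [← hFTC, ← integral_const_mul]
    refine setIntegral_mono_on ?_ (integrableOn_weight_mul_theta hY2) measurableSet_Ioc ?_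
    · exact ((hcont.integrableOn_Icc).mono_set Set.Ioc_subset_Icc_self).const_mul _
    · intro t ht
      have htY : Y < t := ht.1
      have ht0 : 0 < t := by linarith
      have hlt : 0 < Real.log t := Real.log_pos (by linarith)
      obtain ⟨hθt, -⟩ := theta_bounds_exp40 (hY.trans htY.le)
      have hw : 0 ≤ (Real.log t + 1) / (t ^ 2 * Real.log t ^ 2) := by positivity
      calc 0.939 * ((Real.log t + 1) / (t * Real.log t ^ 2))
          = (Real.log t + 1) / (t ^ 2 * Real.log t ^ 2) * (0.939 * t) := by
            field_simp
        _ ≤ (Real.log t + 1) / (t ^ 2 * Real.log t ^ 2) * θ t :=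
            mul_le_mul_of_nonneg_left hθt hw
  have hFX : F X = Real.log (Real.log X) - (Real.log X)⁻¹ := rfl
  have hFY : F Y = Real.log (Real.log Y) - (Real.log Y)⁻¹ := rfl
  rw [hFX, hFY] at h3
  have e1 : (0.939 : ℝ) / Real.log X = 0.939 * (Real.log X)⁻¹ := by rw [div_eq_mul_inv]
  have e2 : (1.0723 : ℝ) / Real.log Y = 1.0723 * (Real.log Y)⁻¹ := by rw [div_eq_mul_inv]
  have e3 : (0.1333 : ℝ) / Real.log Y = 0.1333 * (Real.log Y)⁻¹ := by rw [div_eq_mul_inv]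
  rw [e1] at h1; rw [e2] at h2; rw [e3]
  nlinarith [h1, h2, h3, inv_pos.2 hlY0]

/-! ### Powers of `R` -/

/-- `R^u / p = R^{u - log p/log R}` (as `R^{log p/log R} = p`). [folklore] -/
theorem rpow_div_eq_rpow_sub {R p u : ℝ} (hR : 1 < R) (hp : 0 < p) :
    R ^ u / p = R ^ (u - Real.log p / Real.log R) := by
  have hL : Real.log R ≠ 0 := (Real.log_pos hR).ne'
  have : R ^ (Real.log p / Real.log R) = p := by
    rw [Real.rpow_def_of_pos (by linarith), mul_div_cancel₀ _ hL, Real.exp_log hp]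
  rw [Real.rpow_sub (by linarith), this]

/-- Membership in a prime window `(⌊A⌋, ⌊B⌋]` gives `A < p ≤ B`. [folklore] -/
theorem mem_primeWindow {A B : ℝ} {p : ℕ} (hA : 0 ≤ A) (hB : 0 ≤ B)
    (hp : p ∈ (Finset.Ioc ⌊A⌋₊ ⌊B⌋₊).filter Nat.Prime) : p.Prime ∧ A < p ∧ (p : ℝ) ≤ B := by
  rw [mem_filter, Finset.mem_Ioc] at hp
  exact ⟨hp.2, (Nat.floor_lt hA).1 hp.1.1, (Nat.le_floor_iff hB).1 hp.1.2⟩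

/-! ### Lower bounds for `N₁` -/

/-- `e^{16} ≥ 1000`. [folklore] -/
theorem exp_16_ge : (1000 : ℝ) ≤ Real.exp 16 := by
  have h1 : (2.7182818283 : ℝ) ≤ Real.exp 1 := Real.exp_one_gt_d9.le
  have h2 : (2.7182818283 : ℝ) ^ 16 ≤ Real.exp 1 ^ 16 := by gcongr
  rw [show (16 : ℝ) = ((16 : ℕ) : ℝ) by norm_num, ← Real.exp_one_pow 16]
  exact le_trans (by norm_num) h2

/-- `e^{3} ≥ 20`. [folklore] -/
theorem exp_3_ge : (20 : ℝ) ≤ Real.exp 3 := by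
  have h1 : (2.7182818283 : ℝ) ≤ Real.exp 1 := Real.exp_one_gt_d9.le
  have h2 : (2.7182818283 : ℝ) ^ 3 ≤ Real.exp 1 ^ 3 := by gcongr
  rw [show (3 : ℝ) = ((3 : ℕ) : ℝ) by norm_num, ← Real.exp_one_pow 3]
  exact le_trans (by norm_num) h2

/-- **`N₁(y,R) ≥ 0.936 y/log R` for `R^{0.7} ≤ y ≤ R`**, `log R ≥ 80`.
[cite: Ford2002, proof of Lemma 2.2 (case `d = 2`)] -/
theorem calCN_one_ge_07 {R y : ℝ} (hR1 : 1 < R) (hL : 80 ≤ Real.log R) (hy1 : R ^ (0.7 : ℝ) ≤ y)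
    (hy2 : y ≤ R) :
    0.936 * y / Real.log R ≤ (calCN 1 y R).card := by
  have hR0 : 0 < R := by linarith
  have hL0 : 0 < Real.log R := by linarith
  -- `√R = R^{1/2} ≤ y e^{-16}`
  have hsqrt : Real.sqrt R = R ^ (0.5 : ℝ) := by rw [Real.sqrt_eq_rpow]; norm_num
  have hhalf : R ^ (0.5 : ℝ) * Real.exp 16 ≤ y := by
    have h1 : Real.exp 16 ≤ R ^ (0.2 : ℝ) := by
      rw [Real.rpow_def_of_pos hR0]
      exact Real.exp_le_exp.2 (by nlinarith)
    calc R ^ (0.5 : ℝ) * Real.exp 16 ≤ R ^ (0.5 : ℝ) * R ^ (0.2 : ℝ) :=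
          mul_le_mul_of_nonneg_left h1 (by positivity)
      _ = R ^ (0.7 : ℝ) := by rw [← Real.rpow_add hR0]; norm_num
      _ ≤ y := hy1
  have hsqrt40 : Real.exp 40 ≤ Real.sqrt R := by
    rw [hsqrt, Real.rpow_def_of_pos hR0]
    exact Real.exp_le_exp.2 (by nlinarith)
  have hy40 : Real.exp 40 ≤ y := by
    refine hsqrt40.trans ?_
    rw [hsqrt]
    have : (1:ℝ) ≤ Real.exp 16 := by have := Real.add_one_le_exp (16:ℝ); linarith
    nlinarith [Real.rpow_nonneg hR0.le (0.5:ℝ)]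
  have hy0 : 0 < y := lt_of_lt_of_le (Real.exp_pos 40) hy40
  obtain ⟨hθy, -⟩ := theta_bounds_exp40 hy40
  obtain ⟨-, hθs⟩ := theta_bounds_exp40 hsqrt40
  have hs1 : 1 ≤ Real.sqrt R := le_trans (by have := Real.add_one_le_exp (40:ℝ); linarith) hsqrt40
  have hsy : Real.sqrt R ≤ y := by
    rw [hsqrt]
    have : (1:ℝ) ≤ Real.exp 16 := by have := Real.add_one_le_exp (16:ℝ); linarith
    nlinarith [Real.rpow_nonneg hR0.le (0.5:ℝ)]
  have hN := theta_sub_le_calCN_one_mul_log hs1 hsy hy2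
  -- `θ y - θ √R ≥ 0.936 y`
  have hkey : 0.936 * y ≤ (calCN 1 y R).card * Real.log y := by
    have : 1.0723 * Real.sqrt R ≤ 0.003 * y := by
      rw [hsqrt]
      nlinarith [exp_16_ge, Real.rpow_nonneg hR0.le (0.5:ℝ)]
    linarith
  have hlogy : Real.log y ≤ Real.log R := Real.log_le_log hy0 hy2
  have hlogy0 : 0 < Real.log y :=
    Real.log_pos (lt_of_lt_of_le (by linarith [Real.add_one_le_exp (40:ℝ)]) hy40)
  rw [div_le_iff₀ hL0]
  calc 0.936 * y ≤ (calCN 1 y R).card * Real.log y := hkey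
    _ ≤ (calCN 1 y R).card * Real.log R :=
        mul_le_mul_of_nonneg_left hlogy (Nat.cast_nonneg _)

/-- **`N₁(y,R) ≥ 0.885 y/log R` for `R^{1/2+δ} ≤ y ≤ R`**, `log R ≥ 80`, `δ log R ≥ 3`.
[cite: Ford2002, proof of Lemma 2.2 (case `d = 3`)] -/
theorem calCN_one_ge_half {R y δ : ℝ} (hR1 : 1 < R) (hL : 80 ≤ Real.log R) (hδ : 3 ≤ δ * Real.log R)
    (hy1 : R ^ (0.5 + δ : ℝ) ≤ y) (hy2 : y ≤ R) :
    0.885 * y / Real.log R ≤ (calCN 1 y R).card := by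
  have hR0 : 0 < R := by linarith
  have hL0 : 0 < Real.log R := by linarith
  have hsqrt : Real.sqrt R = R ^ (0.5 : ℝ) := by rw [Real.sqrt_eq_rpow]; norm_num
  have hhalf : R ^ (0.5 : ℝ) * Real.exp 3 ≤ y := by
    have h1 : Real.exp 3 ≤ R ^ (δ : ℝ) := by
      rw [Real.rpow_def_of_pos hR0]
      exact Real.exp_le_exp.2 (by nlinarith)
    calc R ^ (0.5 : ℝ) * Real.exp 3 ≤ R ^ (0.5 : ℝ) * R ^ (δ : ℝ) :=
          mul_le_mul_of_nonneg_left h1 (by positivity)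
      _ = R ^ (0.5 + δ : ℝ) := by rw [← Real.rpow_add hR0]
      _ ≤ y := hy1
  have hsqrt40 : Real.exp 40 ≤ Real.sqrt R := by
    rw [hsqrt, Real.rpow_def_of_pos hR0]
    exact Real.exp_le_exp.2 (by nlinarith)
  have hsy : Real.sqrt R ≤ y := by
    rw [hsqrt]
    have : (1:ℝ) ≤ Real.exp 3 := by have := Real.add_one_le_exp (3:ℝ); linarith
    nlinarith [Real.rpow_nonneg hR0.le (0.5:ℝ)]
  have hy40 : Real.exp 40 ≤ y := hsqrt40.trans hsy
  have hy0 : 0 < y := lt_of_lt_of_le (Real.exp_pos 40) hy40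
  obtain ⟨hθy, -⟩ := theta_bounds_exp40 hy40
  obtain ⟨-, hθs⟩ := theta_bounds_exp40 hsqrt40
  have hs1 : 1 ≤ Real.sqrt R := le_trans (by have := Real.add_one_le_exp (40:ℝ); linarith) hsqrt40
  have hN := theta_sub_le_calCN_one_mul_log hs1 hsy hy2
  have hkey : 0.885 * y ≤ (calCN 1 y R).card * Real.log y := by
    have : 1.0723 * Real.sqrt R ≤ 0.054 * y := by
      rw [hsqrt]
      nlinarith [exp_3_ge, Real.rpow_nonneg hR0.le (0.5:ℝ)]
    linarith
  have hlogy : Real.log y ≤ Real.log R := Real.log_le_log hy0 hy2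
  have hlogy0 : 0 < Real.log y :=
    Real.log_pos (lt_of_lt_of_le (by linarith [Real.add_one_le_exp (40:ℝ)]) hy40)
  rw [div_le_iff₀ hL0]
  calc 0.885 * y ≤ (calCN 1 y R).card * Real.log y := hkey
    _ ≤ (calCN 1 y R).card * Real.log R :=
        mul_le_mul_of_nonneg_left hlogy (Nat.cast_nonneg _)

/-! ### Prime reciprocal sums over `(R^α, R^β]` -/

/-- For `1/2 ≤ α < β ≤ 1` and `log R ≥ 80`:
`∑_{R^α < p ≤ R^β} 1/p ≥ 0.939 log(β/α) − 0.1333/(α log R)`.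
[cite: Ford2002, (2.3) (Chebyshev-strength replacement)] -/
theorem sum_inv_primes_rpow_ge {R α β : ℝ} (hR1 : 1 < R) (hL : 80 ≤ Real.log R) (hα : 1 / 2 ≤ α)
    (hαβ : α ≤ β) :
    0.939 * Real.log (β / α) - 0.1333 / (α * Real.log R)
      ≤ ∑ p ∈ (Finset.Ioc ⌊R ^ α⌋₊ ⌊R ^ β⌋₊).filter Nat.Prime, (1 : ℝ) / p := by
  have hR0 : 0 < R := by linarith
  have hL0 : 0 < Real.log R := by linarith
  have hα0 : 0 < α := by linarith
  have hβ0 : 0 < β := by linarith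
  have hY : Real.exp 40 ≤ R ^ α := by
    rw [Real.rpow_def_of_pos hR0]
    exact Real.exp_le_exp.2 (by nlinarith)
  have hYX : R ^ α ≤ R ^ β := Real.rpow_le_rpow_of_exponent_le hR1.le hαβ
  have h := sum_inv_primes_Ioc_ge hY hYX
  rw [Real.log_rpow hR0, Real.log_rpow hR0, Real.log_mul hβ0.ne' hL0.ne',
    Real.log_mul hα0.ne' hL0.ne'] at h
  rw [Real.log_div hβ0.ne' hα0.ne']
  convert h using 2
  ring

/-! ### The induction of Lemma 2.2 -/

/-- The constants `c_d = (7δ/8)^{d-1}/d!` of the lower bound `N_d(R^u,R) ≥ c_d R^u/log R`.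
[cite: Ford2002, (2.2) (with `δ` replaced by `7δ/8`)] -/
noncomputable def lbConst (δ : ℝ) (d : ℕ) : ℝ := (7 * δ / 8) ^ (d - 1) / (d.factorial : ℝ)

/-- `c_d ≥ 0`. [folklore] -/
theorem lbConst_nonneg {δ : ℝ} (hδ : 0 ≤ δ) (d : ℕ) : 0 ≤ lbConst δ d := by
  unfold lbConst; positivity

/-- `c_{d+1} = c_d (7δ/8)/(d+1)`. [folklore] -/
theorem lbConst_succ {δ : ℝ} {d : ℕ} (hd : 1 ≤ d) :
    lbConst δ (d + 1) = lbConst δ d * (7 * δ / 8) / (d + 1) := by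
  unfold lbConst
  rw [Nat.factorial_succ, Nat.cast_mul, show d + 1 - 1 = (d - 1) + 1 by omega, pow_succ]
  push_cast
  have : (0 : ℝ) < d.factorial := by exact_mod_cast d.factorial_pos
  field_simp

/-- `c_{d+1} ≤ c_d` (`δ ≤ 1/10`). [folklore] -/
theorem lbConst_succ_le {δ : ℝ} (hδ0 : 0 ≤ δ) (hδ : δ ≤ 1 / 10) {d : ℕ} (hd : 1 ≤ d) :
    lbConst δ (d + 1) ≤ lbConst δ d := by
  rw [lbConst_succ hd]
  have h0 := lbConst_nonneg hδ0 d
  have hd1 : (1 : ℝ) ≤ d + 1 := by linarith [(Nat.cast_nonneg d : (0:ℝ) ≤ d)]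
  rw [div_le_iff₀ (by linarith)]
  nlinarith

/-- **One window step in real form**: if `K/p ≤ N_d(x/p, R)` for every prime `p ∈ (R^α, R^β]`
(`1/2 ≤ α ≤ β ≤ 1`) and `S ≤ ∑_{R^α<p≤R^β} 1/p`, then `K S ≤ (d+1) N_{d+1}(x, R)`.
[cite: Ford2002, proof of Lemma 2.2] -/
theorem window_lower {R : ℝ} (hR1 : 1 < R) {d : ℕ} {x α β K S : ℝ} (hx : 0 ≤ x)
    (hα : 1 / 2 ≤ α) (hβ : β ≤ 1) (hK : 0 ≤ K)
    (hpt : ∀ p : ℕ, p.Prime → R ^ α < p → (p : ℝ) ≤ R ^ β → K / p ≤ (calCN d (x / p) R).card)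
    (hS : S ≤ ∑ p ∈ (Finset.Ioc ⌊R ^ α⌋₊ ⌊R ^ β⌋₊).filter Nat.Prime, (1 : ℝ) / p) :
    K * S ≤ (d + 1) * ((calCN (d + 1) x R).card : ℝ) := by
  have hR0 : 0 < R := by linarith
  have hA : Real.sqrt R ≤ R ^ α := by
    rw [Real.sqrt_eq_rpow]
    exact Real.rpow_le_rpow_of_exponent_le hR1.le (by linarith)
  have hB : R ^ β ≤ R := by
    conv_rhs => rw [← Real.rpow_one R]
    exact Real.rpow_le_rpow_of_exponent_le hR1.le hβ
  have hstep := sum_card_calCN_div_le (d := d) hx hA hB (Real.rpow_nonneg hR0.le α)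
  have hstep' : (∑ p ∈ (Finset.Ioc ⌊R ^ α⌋₊ ⌊R ^ β⌋₊).filter Nat.Prime,
      ((calCN d (x / p) R).card : ℝ)) ≤ (d + 1) * ((calCN (d + 1) x R).card : ℝ) := by
    exact_mod_cast hstep
  have hsum : K * ∑ p ∈ (Finset.Ioc ⌊R ^ α⌋₊ ⌊R ^ β⌋₊).filter Nat.Prime, (1 : ℝ) / p
      ≤ ∑ p ∈ (Finset.Ioc ⌊R ^ α⌋₊ ⌊R ^ β⌋₊).filter Nat.Prime, ((calCN d (x / p) R).card : ℝ) := by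
    rw [Finset.mul_sum]
    refine Finset.sum_le_sum fun p hp => ?_
    obtain ⟨hpP, hp1, hp2⟩ := mem_primeWindow (Real.rpow_nonneg hR0.le α) (Real.rpow_nonneg hR0.le β) hp
    rw [mul_one_div]
    exact hpt p hpP hp1 hp2
  calc K * S ≤ K * ∑ p ∈ (Finset.Ioc ⌊R ^ α⌋₊ ⌊R ^ β⌋₊).filter Nat.Prime, (1 : ℝ) / p :=
        mul_le_mul_of_nonneg_left hS hK
    _ ≤ _ := hsum
    _ ≤ _ := hstep'

section Lemma22

variable {R δ : ℝ} (hR1 : 1 < R) (hL : 80 ≤ Real.log R) (hδ0 : 0 < δ) (hδ1 : δ ≤ 1 / 10)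
  (hδL : 3 ≤ δ * Real.log R)
include hR1 hL hδ0 hδ1 hδL

/-- (S3) `∑_{R^{1-δ} < p ≤ R} 1/p ≥ 7δ/8`. [cite: Ford2002, proof of Lemma 2.2 (last display)] -/
theorem sum_inv_primes_step_ge :
    7 * δ / 8 ≤ ∑ p ∈ (Finset.Ioc ⌊R ^ (1 - δ)⌋₊ ⌊R ^ (1 : ℝ)⌋₊).filter Nat.Prime, (1 : ℝ) / p := by
  have hL0 : 0 < Real.log R := by linarith
  have h := sum_inv_primes_rpow_ge hR1 hL (α := 1 - δ) (β := 1) (by linarith) (by linarith)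
  refine le_trans ?_ h
  have hlog : δ ≤ Real.log (1 / (1 - δ)) := by
    rw [one_div, Real.log_inv]
    have := Real.log_le_sub_one_of_pos (show (0:ℝ) < 1 - δ by linarith)
    linarith
  have herr : 0.1333 / ((1 - δ) * Real.log R) ≤ 0.05 * δ := by
    rw [div_le_iff₀ (mul_pos (by linarith) hL0)]
    nlinarith
  nlinarith

/-- (S1) `∑_{R^{1-2δ} < p ≤ R} 1/p ≥ 1.82 δ`. [cite: Ford2002, proof of Lemma 2.2 (case `d = 2`)] -/
theorem sum_inv_primes_base2_ge :
    1.82 * δ ≤ ∑ p ∈ (Finset.Ioc ⌊R ^ (1 - 2 * δ)⌋₊ ⌊R ^ (1 : ℝ)⌋₊).filter Nat.Prime, (1 : ℝ) / p := by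
  have hL0 : 0 < Real.log R := by linarith
  have h := sum_inv_primes_rpow_ge hR1 hL (α := 1 - 2 * δ) (β := 1) (by linarith) (by linarith)
  refine le_trans ?_ h
  have hlog : 2 * δ ≤ Real.log (1 / (1 - 2 * δ)) := by
    rw [one_div, Real.log_inv]
    have := Real.log_le_sub_one_of_pos (show (0:ℝ) < 1 - 2 * δ by linarith)
    linarith
  have herr : 0.1333 / ((1 - 2 * δ) * Real.log R) ≤ 0.056 * δ := by
    rw [div_le_iff₀ (mul_pos (by linarith) hL0)]
    nlinarith
  nlinarith

/-- (S2) `∑_{R^α < p ≤ R^β} 1/p ≥ 1.319 δ` whenever `α ≥ 1/2` and `log(β/α) ≥ 1.5 δ`.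
[cite: Ford2002, proof of Lemma 2.2 (case `d = 3`)] -/
theorem sum_inv_primes_base3_ge {α β : ℝ} (hα : 1 / 2 ≤ α) (hαβ : α ≤ β)
    (hlog : 1.5 * δ ≤ Real.log (β / α)) :
    1.319 * δ ≤ ∑ p ∈ (Finset.Ioc ⌊R ^ α⌋₊ ⌊R ^ β⌋₊).filter Nat.Prime, (1 : ℝ) / p := by
  have hL0 : 0 < Real.log R := by linarith
  have h := sum_inv_primes_rpow_ge hR1 hL hα hαβ
  refine le_trans ?_ h
  have herr : 0.1333 / (α * Real.log R) ≤ 0.0889 * δ := by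
    rw [div_le_iff₀ (by positivity)]
    nlinarith
  nlinarith

/-- **Case `d = 2`**: `N₂(R^u, R) ≥ c₂ R^u/log R` for `2 − 3δ ≤ u ≤ 2 − 2δ`.
[cite: Ford2002, (2.2), case `d = 2`] -/
theorem calCN_two_ge {u : ℝ} (hu1 : 2 - 3 * δ ≤ u) (hu2 : u ≤ 2 - 2 * δ) :
    lbConst δ 2 * R ^ u / Real.log R ≤ (calCN 2 (R ^ u) R).card := by
  have hR0 : 0 < R := by linarith
  have hL0 : 0 < Real.log R := by linarith
  set K : ℝ := 0.936 * R ^ u / Real.log R with hK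
  have hK0 : 0 ≤ K := by positivity
  have hpt : ∀ p : ℕ, p.Prime → R ^ (1 - 2 * δ) < p → (p : ℝ) ≤ R ^ (1 : ℝ) →
      K / p ≤ (calCN 1 (R ^ u / p) R).card := by
    intro p hp h1 h2
    rw [Real.rpow_one] at h2
    have hp0 : (0 : ℝ) < p := by exact_mod_cast hp.pos
    have hy2 : R ^ u / p ≤ R := by
      rw [div_le_iff₀ hp0]
      calc R ^ u ≤ R ^ (1 + (1 - 2 * δ)) :=
            Real.rpow_le_rpow_of_exponent_le hR1.le (by linarith)
        _ = R * R ^ (1 - 2 * δ) := by rw [Real.rpow_add hR0, Real.rpow_one]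
        _ ≤ R * p := mul_le_mul_of_nonneg_left h1.le hR0.le
    have hy1 : R ^ (0.7 : ℝ) ≤ R ^ u / p := by
      rw [le_div_iff₀ hp0]
      calc R ^ (0.7 : ℝ) * p ≤ R ^ (0.7 : ℝ) * R := mul_le_mul_of_nonneg_left h2 (by positivity)
        _ = R ^ (0.7 + 1 : ℝ) := by rw [Real.rpow_add hR0, Real.rpow_one]
        _ ≤ R ^ u := Real.rpow_le_rpow_of_exponent_le hR1.le (by linarith)
    have h := calCN_one_ge_07 hR1 hL hy1 hy2
    have : K / p = 0.936 * (R ^ u / p) / Real.log R := by rw [hK]; field_simp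
    rw [this]
    exact h
  have hw := window_lower hR1 (d := 1) (x := R ^ u) (by positivity) (by linarith) (le_refl 1) hK0 hpt
    (sum_inv_primes_base2_ge hR1 hL hδ0 hδ1 hδL)
  -- `K · 1.82 δ ≤ 2 N₂`
  have hc : lbConst δ 2 = 7 * δ / 16 := by
    unfold lbConst; norm_num [Nat.factorial]; ring
  rw [hc]
  have hRu : 0 ≤ R ^ u / Real.log R := by positivity
  have : 7 * δ / 16 * R ^ u / Real.log R ≤ K * (1.82 * δ) / 2 := by
    rw [hK]
    have : 7 * δ / 16 * R ^ u / Real.log R = (7 * δ / 16) * (R ^ u / Real.log R) := by ring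
    rw [this]
    have : 0.936 * R ^ u / Real.log R * (1.82 * δ) / 2 = (0.936 * 1.82 / 2 * δ) * (R ^ u / Real.log R) := by
      ring
    rw [this]
    exact mul_le_mul_of_nonneg_right (by nlinarith) hRu
  push_cast at hw
  linarith

/-- **Case `d = 3`, one window**: if `1/2 ≤ α ≤ β ≤ 1`, `log(β/α) ≥ 1.5δ`, `u − 2β ≥ 1/2 + δ`
and `u − 2α ≤ 1`, then `N₃(R^u, R) ≥ c₃ R^u/log R` (primes `p₁, p₂ ∈ (R^α, R^β]`, `p₃` counted
by `N₁`). [cite: Ford2002, (2.2), case `d = 3`] -/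
theorem calCN_three_ge_window {u α β : ℝ} (hα : 1 / 2 ≤ α) (hαβ : α ≤ β) (hβ : β ≤ 1)
    (hlog : 1.5 * δ ≤ Real.log (β / α)) (hlow : 0.5 + δ ≤ u - 2 * β) (hup : u - 2 * α ≤ 1) :
    lbConst δ 3 * R ^ u / Real.log R ≤ (calCN 3 (R ^ u) R).card := by
  have hR0 : 0 < R := by linarith
  have hL0 : 0 < Real.log R := by linarith
  have hS := sum_inv_primes_base3_ge hR1 hL hδ0 hδ1 hδL hα hαβ hlog
  -- inner window: `N₂(R^u/p₁) ≥ (0.885/2) (R^u/(p₁ log R)) · 1.319 δ`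
  set K₁ : ℝ := 0.885 / 2 * 1.319 * δ * R ^ u / Real.log R with hK₁
  have hK₁0 : 0 ≤ K₁ := by positivity
  have hpt₁ : ∀ p : ℕ, p.Prime → R ^ α < p → (p : ℝ) ≤ R ^ β →
      K₁ / p ≤ (calCN 2 (R ^ u / p) R).card := by
    intro p₁ hp₁ h11 h12
    have hp₁0 : (0 : ℝ) < p₁ := by exact_mod_cast hp₁.pos
    set K₂ : ℝ := 0.885 * R ^ u / (p₁ * Real.log R) with hK₂
    have hK₂0 : 0 ≤ K₂ := by positivity
    have hpt₂ : ∀ p : ℕ, p.Prime → R ^ α < p → (p : ℝ) ≤ R ^ β →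
        K₂ / p ≤ (calCN 1 (R ^ u / p₁ / p) R).card := by
      intro p₂ hp₂ h21 h22
      have hp₂0 : (0 : ℝ) < p₂ := by exact_mod_cast hp₂.pos
      have hα0 : 0 ≤ R ^ α := by positivity
      have hy2 : R ^ u / p₁ / p₂ ≤ R := by
        rw [div_div, div_le_iff₀ (by positivity)]
        calc R ^ u ≤ R ^ (1 + α + α) := Real.rpow_le_rpow_of_exponent_le hR1.le (by linarith)
          _ = R * (R ^ α * R ^ α) := by
              rw [Real.rpow_add hR0 (1 + α) α, Real.rpow_add hR0 1 α, Real.rpow_one]; ring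
          _ ≤ R * (p₁ * p₂) :=
              mul_le_mul_of_nonneg_left (mul_le_mul h11.le h21.le hα0 hp₁0.le) hR0.le
      have hy1 : R ^ (0.5 + δ : ℝ) ≤ R ^ u / p₁ / p₂ := by
        rw [div_div, le_div_iff₀ (by positivity)]
        calc R ^ (0.5 + δ : ℝ) * (p₁ * p₂) ≤ R ^ (0.5 + δ : ℝ) * (R ^ β * R ^ β) := by
              have : (p₁ : ℝ) * p₂ ≤ R ^ β * R ^ β :=
                mul_le_mul h12 h22 hp₂0.le (by positivity)
              exact mul_le_mul_of_nonneg_left this (by positivity)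
          _ = R ^ (0.5 + δ + β + β : ℝ) := by
              rw [Real.rpow_add hR0 (0.5 + δ + β) β, Real.rpow_add hR0 (0.5 + δ) β]; ring
          _ ≤ R ^ u := Real.rpow_le_rpow_of_exponent_le hR1.le (by linarith)
      have h := calCN_one_ge_half hR1 hL hδL hy1 hy2
      have : K₂ / p₂ = 0.885 * (R ^ u / p₁ / p₂) / Real.log R := by rw [hK₂]; field_simp
      rw [this]
      exact h
    have hw := window_lower hR1 (d := 1) (x := R ^ u / p₁) (by positivity) hα hβ hK₂0 hpt₂ hS
    have : K₁ / p₁ = K₂ * (1.319 * δ) / 2 := by rw [hK₁, hK₂]; field_simp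
    rw [this]
    push_cast at hw
    linarith
  have hw := window_lower hR1 (d := 2) (x := R ^ u) (by positivity) hα hβ hK₁0 hpt₁ hS
  have hc : lbConst δ 3 = 49 * δ ^ 2 / 384 := by
    unfold lbConst; norm_num [Nat.factorial]; ring
  rw [hc]
  have hRu : 0 ≤ R ^ u / Real.log R := by positivity
  have : 49 * δ ^ 2 / 384 * R ^ u / Real.log R ≤ K₁ * (1.319 * δ) / 3 := by
    rw [hK₁]
    have : 49 * δ ^ 2 / 384 * R ^ u / Real.log R = (49 * δ ^ 2 / 384) * (R ^ u / Real.log R) := by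
      ring
    rw [this]
    have : 0.885 / 2 * 1.319 * δ * R ^ u / Real.log R * (1.319 * δ) / 3
        = (0.885 / 2 * 1.319 * 1.319 / 3 * δ ^ 2) * (R ^ u / Real.log R) := by ring
    rw [this]
    exact mul_le_mul_of_nonneg_right (by nlinarith [sq_nonneg δ]) hRu
  push_cast at hw
  linarith

/-- **Case `d = 3`**: `N₃(R^u, R) ≥ c₃ R^u/log R` for `2 − 2δ ≤ u ≤ 3 − 3δ` (three ranges of
`u` with the windows of the source). [cite: Ford2002, (2.2), case `d = 3`] -/
theorem calCN_three_ge {u : ℝ} (hu1 : 2 - 2 * δ ≤ u) (hu2 : u ≤ 3 - 3 * δ) :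
    lbConst δ 3 * R ^ u / Real.log R ≤ (calCN 3 (R ^ u) R).card := by
  rcases lt_or_ge u 2 with h2 | h2
  · -- `I₁ = [2-2δ, 2)`: `α = 1/2`, `β = (u - 1/2 - δ)/2`
    refine calCN_three_ge_window hR1 hL hδ0 hδ1 hδL (α := 1 / 2) (β := (u - 1 / 2 - δ) / 2)
      (le_refl _) (by linarith) (by linarith) ?_ (by linarith) (by linarith)
    have hx : (0 : ℝ) < u - 1 / 2 - δ := by linarith
    have : (u - 1 / 2 - δ) / 2 / (1 / 2) = u - 1 / 2 - δ := by ring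
    rw [this]
    have h1 := Real.one_sub_inv_le_log_of_pos hx
    have h2 : (u - 1 / 2 - δ)⁻¹ ≤ 5 / 6 := by
      rw [inv_eq_one_div, div_le_div_iff₀ hx (by norm_num)]; linarith
    linarith
  rcases lt_or_ge u (2.5 + δ) with h3 | h3
  · -- `I₂ = [2, 2.5+δ)`: `α = (u-1)/2`, `β = (u - 1/2 - δ)/2`
    refine calCN_three_ge_window hR1 hL hδ0 hδ1 hδL (α := (u - 1) / 2) (β := (u - 1 / 2 - δ) / 2)
      (by linarith) (by linarith) (by linarith) ?_ (by linarith) (by linarith)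
    have hx : (0 : ℝ) < u - 1 / 2 - δ := by linarith
    have hx' : (0 : ℝ) < u - 1 := by linarith
    have : (u - 1 / 2 - δ) / 2 / ((u - 1) / 2) = (u - 1 / 2 - δ) / (u - 1) := by
      field_simp
    rw [this]
    have h1 := Real.one_sub_inv_le_log_of_pos (show (0:ℝ) < (u - 1 / 2 - δ) / (u - 1) by positivity)
    have h2 : ((u - 1 / 2 - δ) / (u - 1))⁻¹ ≤ 1 - 0.2 := by
      rw [inv_div, div_le_iff₀ hx]; nlinarith
    linarith
  · -- `I₃ = [2.5+δ, 3-3δ]`: `α = (u-1)/2`, `β = 1`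
    refine calCN_three_ge_window hR1 hL hδ0 hδ1 hδL (α := (u - 1) / 2) (β := 1)
      (by linarith) (by linarith) (le_refl 1) ?_ (by linarith) (by linarith)
    have hx' : (0 : ℝ) < u - 1 := by linarith
    have : (1 : ℝ) / ((u - 1) / 2) = 2 / (u - 1) := by field_simp
    rw [this]
    have h1 := Real.one_sub_inv_le_log_of_pos (show (0:ℝ) < 2 / (u - 1) by positivity)
    have h2 : (2 / (u - 1))⁻¹ ≤ 1 - 1.5 * δ := by
      rw [inv_div, div_le_iff₀ (by norm_num : (0:ℝ) < 2)]; linarith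
    linarith

/-- The inductive claim (2.2): `N_d(R^u, R) ≥ c_d R^u/log R` for `2 − 3δ ≤ u < d(1 − δ)`, all
`d ≥ 2`. [cite: Ford2002, (2.2)] -/
theorem calCN_ge_induction {d : ℕ} (hd : 2 ≤ d) {u : ℝ} (hu1 : 2 - 3 * δ ≤ u)
    (hu2 : u < d * (1 - δ)) :
    lbConst δ d * R ^ u / Real.log R ≤ (calCN d (R ^ u) R).card := by
  have hR0 : 0 < R := by linarith
  have hL0 : 0 < Real.log R := by linarith
  induction d, hd using Nat.le_induction generalizing u with
  | base =>
    exact calCN_two_ge hR1 hL hδ0 hδ1 hδL hu1 (by push_cast at hu2; linarith)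
  | succ d hd ih =>
    -- below `d(1-δ)`: monotonicity in `d`
    rcases lt_or_ge u (d * (1 - δ)) with hlt | hge
    · have h1 := ih hu1 hlt
      have h2 : ((calCN d (R ^ u) R).card : ℝ) ≤ (calCN (d + 1) (R ^ u) R).card := by
        exact_mod_cast Finset.card_le_card (calCN_mono (Nat.le_succ d) _ _)
      have h3 : lbConst δ (d + 1) * R ^ u / Real.log R ≤ lbConst δ d * R ^ u / Real.log R := by
        have := lbConst_succ_le hδ0.le hδ1 (d := d) (by omega)
        have hRu : 0 ≤ R ^ u / Real.log R := by positivity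
        calc lbConst δ (d + 1) * R ^ u / Real.log R = lbConst δ (d + 1) * (R ^ u / Real.log R) := by ring
          _ ≤ lbConst δ d * (R ^ u / Real.log R) := mul_le_mul_of_nonneg_right this hRu
          _ = _ := by ring
      linarith
    -- `d(1-δ) ≤ u < (d+1)(1-δ)`
    rcases eq_or_lt_of_le hd with rfl | hd3
    · -- `d = 2`: the case `d = 3` directly
      exact calCN_three_ge hR1 hL hδ0 hδ1 hδL (by push_cast at hge; linarith)
        (by push_cast at hu2; linarith)
    · -- `d ≥ 3`: one window step from the induction hypothesis
      have hd3' : (3 : ℝ) ≤ d := by exact_mod_cast hd3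
      set K : ℝ := lbConst δ d * R ^ u / Real.log R with hK
      have hK0 : 0 ≤ K := by have := lbConst_nonneg hδ0.le d; positivity
      have hpt : ∀ p : ℕ, p.Prime → R ^ (1 - δ) < p → (p : ℝ) ≤ R ^ (1 : ℝ) →
          K / p ≤ (calCN d (R ^ u / p) R).card := by
        intro p hp h1 h2
        rw [Real.rpow_one] at h2
        have hp0 : (0 : ℝ) < p := by exact_mod_cast hp.pos
        set u' : ℝ := u - Real.log p / Real.log R with hu'
        have hy : R ^ u / p = R ^ u' := rpow_div_eq_rpow_sub hR1 hp0
        have hlogp1 : (1 - δ) * Real.log R < Real.log p := by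
          have := Real.log_lt_log (by positivity) h1
          rwa [Real.log_rpow hR0] at this
        have hlogp2 : Real.log p ≤ Real.log R := Real.log_le_log hp0 h2
        have hu'1 : 2 - 3 * δ ≤ u' := by
          rw [hu']
          have : Real.log p / Real.log R ≤ 1 := by rw [div_le_one hL0]; exact hlogp2
          nlinarith
        have hu'2 : u' < d * (1 - δ) := by
          rw [hu']
          have : 1 - δ < Real.log p / Real.log R := by rw [lt_div_iff₀ hL0]; exact hlogp1
          push_cast at hu2
          linarith
        have h := ih hu'1 hu'2
        rw [hy]
        have : K / p = lbConst δ d * R ^ u' / Real.log R := by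
          rw [hK, ← hy]; field_simp
        rw [this]
        exact h
      have hw := window_lower hR1 (d := d) (x := R ^ u) (by positivity) (by linarith) (le_refl 1) hK0
        hpt (sum_inv_primes_step_ge hR1 hL hδ0 hδ1 hδL)
      rw [lbConst_succ (by omega)]
      have hd1 : (0 : ℝ) < d + 1 := by positivity
      have : lbConst δ d * (7 * δ / 8) / (d + 1) * R ^ u / Real.log R = K * (7 * δ / 8) / (d + 1) := by
        rw [hK]; field_simp
      rw [this, div_le_iff₀ hd1]
      linarith

/-- **Ford's Lemma 2.2 (Chebyshev-strength form).** Let `𝒞(P,R)` be the set of positive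
integers `n ≤ P` all of whose prime factors lie in `(√R, R]`. If `0 < δ ≤ 1/10`, `log R ≥ 80`,
`δ log R ≥ 3` and `u ≥ 2 − 3δ`, then with `w = ⌊u/(1−δ)⌋`,

  `|𝒞(R^u, R)| ≥ (7δ/8)^w/(w+1)! · R^u/log R`.

The source (Lemma 2.2: `R ≥ 6^{1/δ}`, constant `δ^w/(w+1)!`) argues identically from the
Rosser–Schoenfeld bounds (2.1), (2.3); here the prime-sum input is the Chebyshev–Sylvester bound
`0.939 x ≤ θ(x) ≤ 1.0723 x` (`x ≥ e^{40}`) of the tree, which costs the factor `(7/8)^w` and the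
stronger largeness hypotheses — harmless in §5 of the source, where `log R ≥ 84`, `δ = 1/26` and
the bound enters through `C₃^{1/r}` in (5.19), (5.30). [cite: Ford2002, Lemma 2.2] -/
theorem card_calC_ge {u : ℝ} (hu : 2 - 3 * δ ≤ u) :
    (7 * δ / 8) ^ ⌊u / (1 - δ)⌋₊ / ((⌊u / (1 - δ)⌋₊ + 1).factorial : ℝ) * R ^ u / Real.log R
      ≤ (calC (R ^ u) R).card := by
  set w := ⌊u / (1 - δ)⌋₊ with hw
  have h1δ : 0 < 1 - δ := by linarith
  have hwu : u < (w + 1 : ℕ) * (1 - δ) := by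
    have := Nat.lt_floor_add_one (u / (1 - δ))
    rw [← hw] at this
    push_cast
    rwa [div_lt_iff₀ h1δ] at this
  have hw1 : 2 ≤ w + 1 := by
    have : 1 ≤ w := by
      rw [hw]
      refine Nat.le_floor ?_
      push_cast
      rw [le_div_iff₀ h1δ]; linarith
    omega
  have h := calCN_ge_induction hR1 hL hδ0 hδ1 hδL hw1 hu hwu
  have hc : lbConst δ (w + 1) = (7 * δ / 8) ^ w / ((w + 1).factorial : ℝ) := by
    unfold lbConst; simp
  rw [hc] at h
  refine h.trans ?_
  exact_mod_cast Finset.card_le_card (calCN_subset (w + 1) (R ^ u) R)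

end Lemma22

/-- **The case `δ = 1/26` of `FordVK.card_calC_ge`** (the value used in §5 of the source): for
`log R ≥ 80` and `u ≥ 2`, `|𝒞(R^u,R)| ≥ (7/208)^w/(w+1)! · R^u/log R` with `w = ⌊26u/25⌋`.
[cite: Ford2002, Lemma 2.2 and (5.19)] -/
theorem card_calC_ge_26 {R u : ℝ} (hR1 : 1 < R) (hL : 80 ≤ Real.log R) (hu : 2 ≤ u) :
    (7 / 208 : ℝ) ^ ⌊26 * u / 25⌋₊ / ((⌊26 * u / 25⌋₊ + 1).factorial : ℝ) * R ^ u / Real.log R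
      ≤ (calC (R ^ u) R).card := by
  have h := card_calC_ge hR1 hL (δ := 1 / 26) (by norm_num) (by norm_num) (by linarith) (u := u)
    (by linarith)
  have e1 : u / (1 - 1 / 26) = 26 * u / 25 := by ring
  have e2 : (7 : ℝ) * (1 / 26) / 8 = 7 / 208 := by norm_num
  rw [e1, e2] at h
  exact h


end FordVK
end Literature.NumberTheory.LFunctions
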